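import Summits.Parity.GeneralizedHardyLittlewood.Theorems.ChenParityOracleBLAPHostParityFromBrickSwitchedBoxes
import HarnessLib

/-!
# Route `ChenParityOracleBLAP` — crux S1 = `HostParityFromBrick` (stmt-Parity-20045): Type-II pieces — `ρ`-adic classes of pairs

Support file for the prime half `K1 → K2 → HP1` of S1 (Type-II dispatch of Vaughan's identity).
A hyperbolic pair sum `∑_{M < m ≤ 2M} ∑_{V₀ < n ≤ y/m} F(m,n)` is decomposed by the `ρ`-adic
indices `⌊log m/log ρ⌋`, `⌊log n/log ρ⌋` (`pair_sum_eq_sum_classes`); a GOOD class `(i, c)`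
(`ρ^{i+c+2} ≤ y`, `V₀ < ρ^c`) is a full box sum over `(Mᵢ, 2Mᵢ] × (N_c, 2N_c]`,
`Mᵢ = ⌈ρ^i⌉ − 1`, `N_c = ⌈ρ^c⌉ − 1`, with indicator-restricted coefficients
(`good_class_eq_box`); the number of classes is controlled by `floor_log_div_le`.

References: H. Iwaniec, E. Kowalski, *Analytic Number Theory* (2004), §13.4, §17.3
[IwaniecKowalski2004].
-/

namespace Summit.Parity.GeneralizedHardyLittlewood.Theorems

open Finset Real

/-- **Class decomposition of a hyperbolic pair sum.**  For `ρ > 1`: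
`∑_{M<m≤2M} ∑_{V₀<n≤y/m} F(m,n) = ∑_{i ≤ cls(2M)} ∑_{c ≤ cls(y)} ∑_{m: cls m = i} ∑_{n: cls n = c} F(m,n)`
with `cls t = ⌊log t/log ρ⌋`. -/
theorem pair_sum_eq_sum_classes {ρ : ℝ} (hρ : 1 < ρ) (M y V₀ : ℕ) (F : ℕ → ℕ → ℝ) :
    ∑ m ∈ Ioc M (2 * M), ∑ n ∈ Ioc V₀ (y / m), F m n =
      ∑ i ∈ range (⌊Real.log (2 * M : ℕ) / Real.log ρ⌋₊ + 1),
        ∑ c ∈ range (⌊Real.log y / Real.log ρ⌋₊ + 1),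
          ∑ m ∈ (Ioc M (2 * M)).filter (fun m : ℕ => ⌊Real.log (m : ℝ) / Real.log ρ⌋₊ = i),
            ∑ n ∈ (Ioc V₀ (y / m)).filter (fun n : ℕ => ⌊Real.log (n : ℝ) / Real.log ρ⌋₊ = c), F m n := by
  classical
  -- fibrewise in `m`
  have hm : ∀ m ∈ Ioc M (2 * M), ⌊Real.log m / Real.log ρ⌋₊ ∈
      range (⌊Real.log (2 * M : ℕ) / Real.log ρ⌋₊ + 1) := by
    intro m hm
    rw [Finset.mem_Ioc] at hm
    rw [Finset.mem_range, Nat.lt_succ_iff]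
    exact floor_log_div_mono hρ hm.2
  rw [← Finset.sum_fiberwise_of_maps_to hm]
  refine Finset.sum_congr rfl fun i _ => ?_
  -- fibrewise in `n`, then swap
  have hinner : ∀ m ∈ (Ioc M (2 * M)).filter (fun m : ℕ => ⌊Real.log (m : ℝ) / Real.log ρ⌋₊ = i),
      ∑ n ∈ Ioc V₀ (y / m), F m n = ∑ c ∈ range (⌊Real.log y / Real.log ρ⌋₊ + 1),
        ∑ n ∈ (Ioc V₀ (y / m)).filter (fun n : ℕ => ⌊Real.log (n : ℝ) / Real.log ρ⌋₊ = c), F m n := by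
    intro m _
    have hn : ∀ n ∈ Ioc V₀ (y / m), ⌊Real.log n / Real.log ρ⌋₊ ∈
        range (⌊Real.log y / Real.log ρ⌋₊ + 1) := by
      intro n hn
      rw [Finset.mem_Ioc] at hn
      rw [Finset.mem_range, Nat.lt_succ_iff]
      exact floor_log_div_mono hρ (hn.2.trans (Nat.div_le_self y m))
    rw [← Finset.sum_fiberwise_of_maps_to hn]
  rw [Finset.sum_congr rfl hinner, Finset.sum_comm]

/-- Members of the class `c` lie in `[ρ^c, ρ^{c+1})`. -/
theorem rho_class_bounds {ρ : ℝ} (hρ : 1 < ρ) {n c : ℕ} (hn : 1 ≤ n)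
    (hc : ⌊Real.log n / Real.log ρ⌋₊ = c) : ρ ^ c ≤ (n : ℝ) ∧ (n : ℝ) < ρ ^ (c + 1) := by
  have h1 := rho_pow_floor_le hρ hn
  have h2 := lt_rho_pow_floor_succ hρ n
  rw [hc] at h1 h2
  exact ⟨h1, h2⟩

/-- **A good class is a full box.**  For `ρ ∈ (1, 6/5]`, `2 ≤ ρ^i`, `2 ≤ ρ^c`, `ρ^{i+c+2} ≤ y`
and `V₀ < ρ^c`: with `Mᵢ = ⌈ρ^i⌉ − 1`, `N_c = ⌈ρ^c⌉ − 1`,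
`∑_{M<m≤2M, cls m = i} ∑_{V₀<n≤y/m, cls n = c} F(m,n)`
`= ∑_{Mᵢ<m≤2Mᵢ} ∑_{N_c<n≤2N_c} [M<m≤2M ∧ cls m = i] [cls n = c] F(m,n)`. -/
theorem good_class_eq_box {ρ : ℝ} (hρ : 1 < ρ) (hρ2 : ρ ≤ 6 / 5) {M y V₀ i c : ℕ}
    (hi2 : (2 : ℝ) ≤ ρ ^ i) (hc2 : (2 : ℝ) ≤ ρ ^ c) (htop : ρ ^ (i + c + 2) ≤ (y : ℝ))
    (hV₀ : (V₀ : ℝ) < ρ ^ c) (F : ℕ → ℕ → ℝ) :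
    ∑ m ∈ (Ioc M (2 * M)).filter (fun m : ℕ => ⌊Real.log (m : ℝ) / Real.log ρ⌋₊ = i),
        ∑ n ∈ (Ioc V₀ (y / m)).filter (fun n : ℕ => ⌊Real.log (n : ℝ) / Real.log ρ⌋₊ = c), F m n =
      ∑ m ∈ Ioc (⌈ρ ^ i⌉₊ - 1) (2 * (⌈ρ ^ i⌉₊ - 1)),
        ∑ n ∈ Ioc (⌈ρ ^ c⌉₊ - 1) (2 * (⌈ρ ^ c⌉₊ - 1)),
          (if m ∈ Ioc M (2 * M) ∧ ⌊Real.log m / Real.log ρ⌋₊ = i then (1 : ℝ) else 0) *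
            ((if ⌊Real.log n / Real.log ρ⌋₊ = c then (1 : ℝ) else 0) * F m n) := by
  classical
  have hρ0 : (0 : ℝ) < ρ := by linarith
  -- rewrite the RHS as a sum over filters
  have hR : ∑ m ∈ Ioc (⌈ρ ^ i⌉₊ - 1) (2 * (⌈ρ ^ i⌉₊ - 1)),
        ∑ n ∈ Ioc (⌈ρ ^ c⌉₊ - 1) (2 * (⌈ρ ^ c⌉₊ - 1)),
          (if m ∈ Ioc M (2 * M) ∧ ⌊Real.log m / Real.log ρ⌋₊ = i then (1 : ℝ) else 0) *
            ((if ⌊Real.log n / Real.log ρ⌋₊ = c then (1 : ℝ) else 0) * F m n) =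
      ∑ m ∈ (Ioc (⌈ρ ^ i⌉₊ - 1) (2 * (⌈ρ ^ i⌉₊ - 1))).filter
          (fun m : ℕ => m ∈ Ioc M (2 * M) ∧ ⌊Real.log (m : ℝ) / Real.log ρ⌋₊ = i),
        ∑ n ∈ (Ioc (⌈ρ ^ c⌉₊ - 1) (2 * (⌈ρ ^ c⌉₊ - 1))).filter
          (fun n : ℕ => ⌊Real.log (n : ℝ) / Real.log ρ⌋₊ = c), F m n := by
    rw [Finset.sum_filter]
    refine Finset.sum_congr rfl fun m _ => ?_
    split_ifs with hm
    · rw [Finset.sum_filter]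
      refine Finset.sum_congr rfl fun n _ => ?_
      split_ifs <;> simp
    · exact Finset.sum_eq_zero fun n _ => by rw [zero_mul]
  rw [hR]
  -- the `m`-index sets agree
  have hMset : (Ioc M (2 * M)).filter (fun m : ℕ => ⌊Real.log (m : ℝ) / Real.log ρ⌋₊ = i) =
      (Ioc (⌈ρ ^ i⌉₊ - 1) (2 * (⌈ρ ^ i⌉₊ - 1))).filter
        (fun m : ℕ => m ∈ Ioc M (2 * M) ∧ ⌊Real.log (m : ℝ) / Real.log ρ⌋₊ = i) := by
    ext m
    simp only [Finset.mem_filter]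
    constructor
    · rintro ⟨hm, hmi⟩
      have hm1 : 1 ≤ m := by rw [Finset.mem_Ioc] at hm; omega
      obtain ⟨h1, h2⟩ := rho_class_bounds hρ hm1 hmi
      exact ⟨mem_Ioc_of_rho_interval hρ hρ2 (e := 1) (by norm_num) hi2 h1 h2, hm, hmi⟩
    · rintro ⟨-, hm, hmi⟩
      exact ⟨hm, hmi⟩
  rw [← hMset]
  refine Finset.sum_congr rfl fun m hm => ?_
  rw [Finset.mem_filter] at hm
  obtain ⟨hmM, hmi⟩ := hm
  have hm1 : 1 ≤ m := by rw [Finset.mem_Ioc] at hmM; omega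
  obtain ⟨hmlo, hmhi⟩ := rho_class_bounds hρ hm1 hmi
  -- the `n`-index sets agree
  congr 1
  ext n
  simp only [Finset.mem_filter]
  constructor
  · rintro ⟨hn, hnc⟩
    have hn1 : 1 ≤ n := by rw [Finset.mem_Ioc] at hn; omega
    obtain ⟨h1, h2⟩ := rho_class_bounds hρ hn1 hnc
    exact ⟨mem_Ioc_of_rho_interval hρ hρ2 (e := 1) (by norm_num) hc2 h1 h2, hnc⟩
  · rintro ⟨hn, hnc⟩
    have hn1 : 1 ≤ n := by
      rw [Finset.mem_Ioc] at hn
      have : 1 ≤ ⌈ρ ^ c⌉₊ := Nat.one_le_ceil_iff.mpr (by linarith)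
      omega
    obtain ⟨h1, h2⟩ := rho_class_bounds hρ hn1 hnc
    refine ⟨?_, hnc⟩
    rw [Finset.mem_Ioc]
    constructor
    · exact_mod_cast hV₀.trans_le h1
    · -- `m n < ρ^{i+1} ρ^{c+1} = ρ^{i+c+2} ≤ y`
      have hmn : ((m * n : ℕ) : ℝ) < (y : ℝ) := by
        push_cast
        calc (m : ℝ) * n < ρ ^ (i + 1) * ρ ^ (c + 1) :=
              mul_lt_mul'' hmhi h2 (Nat.cast_nonneg m) (Nat.cast_nonneg n)
          _ = ρ ^ (i + c + 2) := by rw [← pow_add]; ring_nf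
          _ ≤ y := htop
      have hmn' : m * n ≤ y := (by exact_mod_cast hmn : m * n < y).le
      exact (Nat.le_div_iff_mul_le (by omega)).2 (by rw [mul_comm]; exact hmn')

/-- `log ρ ≥ (ρ − 1)/2` for `1 < ρ ≤ 2`; hence `⌊log t/log ρ⌋ ≤ 2 log t/(ρ−1)` for `t ≥ 1`. -/
theorem floor_log_div_le {ρ : ℝ} (hρ : 1 < ρ) (hρ2 : ρ ≤ 2) {t : ℕ} (ht : 1 ≤ t) :
    (⌊Real.log t / Real.log ρ⌋₊ : ℝ) ≤ 2 * Real.log t / (ρ - 1) := by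
  have hlt : 0 ≤ Real.log t := Real.log_nonneg (by exact_mod_cast ht)
  have hlρ : 0 < Real.log ρ := Real.log_pos hρ
  -- `(ρ - 1)/2 ≤ log ρ`: from `log ρ ≥ 1 - 1/ρ = (ρ-1)/ρ ≥ (ρ-1)/2`
  have h1 : (ρ - 1) / 2 ≤ Real.log ρ := by
    have h := Real.add_one_le_exp (-Real.log ρ)
    rw [Real.exp_neg, Real.exp_log (by linarith)] at h
    have hρ0 : (0 : ℝ) < ρ := by linarith
    have h2 : 1 - Real.log ρ ≤ ρ⁻¹ := by linarith
    have h3 : ρ⁻¹ ≤ 1 - (ρ - 1) / 2 := by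
      rw [inv_eq_one_div, div_le_iff₀ hρ0]; nlinarith
    linarith
  calc (⌊Real.log t / Real.log ρ⌋₊ : ℝ) ≤ Real.log t / Real.log ρ := Nat.floor_le (by positivity)
    _ ≤ Real.log t / ((ρ - 1) / 2) := div_le_div_of_nonneg_left hlt (by linarith) h1
    _ = 2 * Real.log t / (ρ - 1) := by field_simp

end Summit.Parity.GeneralizedHardyLittlewood.Theorems
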